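import Literature.Probability.Percolation.KozmaNitzanPreFKG
import Summits.CriticalPhenomena.PercolationContinuityZ3.Theorems.PercNearOneGluingNoHeavyLowerTailBHKMixedAvoidance
import HarnessLib

/-!
# Bernstein positivity of avoidance covariances — tools (event forms of BHK 2006, Thm. 1.3)

Support lemma for the crux `AdditiveGluing` (stmt-CriticalPhenomena-4576), line `tieline`,
kernel `stub_k0CovTransferQ_c9`.  Expanding the killed ("ghost-avoiding") cluster laws of the
kernel's L-face master inequality over the ghost's kill pattern turns it into positivity
statements for *symmetrised multi-slot avoidance forms* in plain Bernoulli percolation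
(memo `EXCHCERT-g5.md` §7–§8 on the item).  This file proves the two-slot member of that family,
a strengthening of van den Berg–Häggström–Kahn 2006, Thm. 1.3:

for bond percolation `μ = prodBernoulli w` on a finite graph, a vertex `v`, two events `𝒰, 𝒪`
increasing in the open edge cluster `C_v`, and disjoint vertex sets `Z, A` not containing `v`,
writing `R_X = {v ↮ X}`,

`0 ≤ ∑_{S ⊆ A} [ μ(𝒰 ∩ 𝒪 ∩ R_{Z ∪ S}) μ(R_{Z ∪ (A∖S)}) − μ(𝒰 ∩ R_{Z ∪ S}) μ(𝒪 ∩ R_{Z ∪ (A∖S)}) ]`.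

For `A = ∅` this is BHK Thm. 1.3 (positive association of `C_v` given `{v ↮ Z}`); for general `A`
it says that the un-normalised covariance of `𝒰, 𝒪` under the law of `C_v` killed independently at
the vertices of `A` has non-negative multivariate Bernstein coefficients in the kill probabilities.

Proof (paper proof in the memo, §8.1): pair `S` with `A ∖ S`; the pair sum equals
`w(S)·[Cov(𝒰,𝒪 | R_a) + Cov(𝒰,𝒪 | R_b) + (f a − f b)(g a − g b)]` with `a = Z ∪ S`,
`b = Z ∪ (A∖S)`, `w(S) = μ(R_a)μ(R_b)`, `f X = μ(𝒰 | R_X)`, `g X = μ(𝒪 | R_X)`; the conditional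
covariances are `≥ 0` by BHK Thm. 1.3, `f, g` are antitone in the avoidance set (BHK Thm. 1.3,
increasing × decreasing case), `w` is log-supermodular on the Boolean lattice `2^A` (BHK Thm. 1.3,
decreasing × decreasing case), and the odd parts `S ↦ f a − f b`, `S ↦ g a − g b` have `w`-mean
zero, so the Fortuin–Kasteleyn–Ginibre inequality on `(2^A, w)` (Mathlib `fkg`) gives
`∑ w (f a − f b)(g a − g b) ≥ 0`.

References: J. van den Berg, O. Häggström, J. Kahn, *Some conditional correlation inequalities for
percolation and related processes*, Random Struct. Alg. 29 (2006), Thm. 1.1 (p. 3), Thm. 1.3 (p. 6)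
[VandenbergHaggstromKahn2005]; C. Fortuin, P. Kasteleyn, J. Ginibre (1971) / R. Ahlswede,
D. Daykin (1978), four functions theorem (Mathlib `four_functions_theorem`, `fkg`).
-/

namespace Summit.CriticalPhenomena.PercolationContinuityZ3.Theorems

open MeasureTheory Set
open Literature.Probability.LatticeModels (prodBernoulli)
open Literature.Probability.Percolation Literature.Probability.Percolation.KNPreFKG

namespace AvoidanceCovBernstein

variable {V : Type*}

/-- The family of edge sets avoiding the vertex set `Y` is a lower family. [folklore] -/
theorem isLowerSet_avoidFam (Y : Finset V) :
    IsLowerSet {C : Set (Sym2 V) | ∀ e ∈ C, ∀ y ∈ Y, y ∉ e} :=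
  fun _ _ hDC hC e he y hy => hC e (hDC he) y hy

/-- For `v ∉ Y`: `C_v` avoids `Y` (no edge of the edge cluster meets `Y`) iff `v ↮ Y`.
[cite: VandenbergHaggstromKahn2005, §1 p. 3 (definition of `R_X`)] -/
theorem setOf_cluster_avoid_eq (v : V) (Y : Finset V) (hv : v ∉ Y) :
    {ω : BondConfig V | openEdgeCluster ω v ∈ {C : Set (Sym2 V) | ∀ e ∈ C, ∀ y ∈ Y, y ∉ e}} =
      {ω : BondConfig V | ∀ y ∈ Y, ¬ (openGraph ω).Reachable v y} := by
  ext ω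
  simp only [mem_setOf_eq]
  constructor
  · intro h y hy hr
    rcases (reachable_iff_exists_mem_openEdgeCluster ω v y).1 hr with rfl | ⟨e, he, hye⟩
    · exact hv hy
    · exact h e he y hy hye
  · intro h e he y hy hye
    exact h y hy ((reachable_iff_exists_mem_openEdgeCluster ω v y).2 (Or.inr ⟨e, he, hye⟩))

/-- `R_{X ∪ Y} = R_X ∩ R_Y`. [folklore] -/
theorem R_union [DecidableEq V] (v : V) (X Y : Finset V) :
    {ω : BondConfig V | ∀ x ∈ X ∪ Y, ¬ (openGraph ω).Reachable v x} =
      {ω : BondConfig V | ∀ x ∈ X, ¬ (openGraph ω).Reachable v x} ∩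
        {ω : BondConfig V | ∀ x ∈ Y, ¬ (openGraph ω).Reachable v x} := by
  ext ω
  simp only [mem_setOf_eq, mem_inter_iff, Finset.mem_union]
  exact ⟨fun h => ⟨fun x hx => h x (Or.inl hx), fun x hx => h x (Or.inr hx)⟩,
    fun h x hx => hx.elim (h.1 x) (h.2 x)⟩

/-- If `X ⊆ X'` then `R_{X'} ⊆ R_X`. [folklore] -/
theorem R_anti (v : V) {X X' : Finset V} (h : X ⊆ X') :
    {ω : BondConfig V | ∀ x ∈ X', ¬ (openGraph ω).Reachable v x} ⊆
      {ω : BondConfig V | ∀ x ∈ X, ¬ (openGraph ω).Reachable v x} :=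
  fun _ hω x hx => hω x (h hx)

variable [Fintype V] (w : Sym2 V → unitInterval) (v : V) (𝒜 ℬ : Set (Set (Sym2 V)))

/-- **BHK Thm. 1.3, positive association given avoidance** (event form used here):
`μ(𝒰 ∩ R_X) μ(𝒪 ∩ R_X) ≤ μ(R_X) μ(𝒰 ∩ 𝒪 ∩ R_X)` for `𝒰, 𝒪` increasing in `C_v`, `v ∉ X`.
[cite: VandenbergHaggstromKahn2005, Thm. 1.3 (p. 6)] -/
theorem pa (h𝒜 : IsUpperSet 𝒜) (hℬ : IsUpperSet ℬ) (X : Finset V) (hv : v ∉ X) :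
    (prodBernoulli w).real ({ω : BondConfig V | openEdgeCluster ω v ∈ 𝒜} ∩
        {ω | ∀ x ∈ X, ¬ (openGraph ω).Reachable v x}) *
      (prodBernoulli w).real ({ω : BondConfig V | openEdgeCluster ω v ∈ ℬ} ∩
        {ω | ∀ x ∈ X, ¬ (openGraph ω).Reachable v x}) ≤
    (prodBernoulli w).real {ω : BondConfig V | ∀ x ∈ X, ¬ (openGraph ω).Reachable v x} *
      (prodBernoulli w).real ({ω : BondConfig V | openEdgeCluster ω v ∈ 𝒜} ∩
        {ω : BondConfig V | openEdgeCluster ω v ∈ ℬ} ∩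
        {ω | ∀ x ∈ X, ¬ (openGraph ω).Reachable v x}) := by
  have hv' : v ∉ (↑X : Set V) := fun h => hv (Finset.mem_coe.1 h)
  have key := bhk_one_upper_upper w v (↑X : Set V) hv' h𝒜 hℬ
  have e0 : {ω : BondConfig V | ∀ x ∈ (↑X : Set V), ¬ (openGraph ω).Reachable v x} =
      {ω : BondConfig V | ∀ x ∈ X, ¬ (openGraph ω).Reachable v x} := by
    ext ω; simp only [mem_setOf_eq, Finset.mem_coe]
  rw [e0] at key
  rw [inter_comm ({ω : BondConfig V | openEdgeCluster ω v ∈ 𝒜}),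
    inter_comm ({ω : BondConfig V | openEdgeCluster ω v ∈ ℬ}), inter_comm _ ({ω : BondConfig V |
      ∀ x ∈ X, ¬ (openGraph ω).Reachable v x})]
  exact key

/-- **BHK Thm. 1.3 (increasing × decreasing): more avoidance lowers increasing events**,
`μ(R_X) μ(𝒰 ∩ R_{X'}) ≤ μ(𝒰 ∩ R_X) μ(R_{X'})` for `X ⊆ X'`, `v ∉ X'`.
[cite: VandenbergHaggstromKahn2005, Thm. 1.1 (p. 3) with `B = Ω`; Thm. 1.3 (p. 6, last sentence)] -/
theorem mono (h𝒜 : IsUpperSet 𝒜) {X X' : Finset V} (hXX' : X ⊆ X') (hv : v ∉ X') :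
    (prodBernoulli w).real {ω : BondConfig V | ∀ x ∈ X, ¬ (openGraph ω).Reachable v x} *
      (prodBernoulli w).real ({ω : BondConfig V | openEdgeCluster ω v ∈ 𝒜} ∩
        {ω | ∀ x ∈ X', ¬ (openGraph ω).Reachable v x}) ≤
    (prodBernoulli w).real ({ω : BondConfig V | openEdgeCluster ω v ∈ 𝒜} ∩
        {ω | ∀ x ∈ X, ¬ (openGraph ω).Reachable v x}) *
      (prodBernoulli w).real {ω : BondConfig V | ∀ x ∈ X', ¬ (openGraph ω).Reachable v x} := by
  have hvX : v ∉ X := fun h => hv (hXX' h)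
  have hv' : v ∉ (↑X : Set V) := fun h => hvX (Finset.mem_coe.1 h)
  have key := bhk_one_upper_lower w v (↑X : Set V) hv' h𝒜 (isLowerSet_avoidFam X')
  have e0 : {ω : BondConfig V | ∀ x ∈ (↑X : Set V), ¬ (openGraph ω).Reachable v x} =
      {ω : BondConfig V | ∀ x ∈ X, ¬ (openGraph ω).Reachable v x} := by
    ext ω; simp only [mem_setOf_eq, Finset.mem_coe]
  rw [e0, setOf_cluster_avoid_eq v X' hv] at key
  -- `R_X ∩ R_{X'} = R_{X'}`
  have e1 : {ω : BondConfig V | ∀ x ∈ X, ¬ (openGraph ω).Reachable v x} ∩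
      ({ω : BondConfig V | openEdgeCluster ω v ∈ 𝒜} ∩
        {ω : BondConfig V | ∀ x ∈ X', ¬ (openGraph ω).Reachable v x}) =
      {ω : BondConfig V | openEdgeCluster ω v ∈ 𝒜} ∩
        {ω : BondConfig V | ∀ x ∈ X', ¬ (openGraph ω).Reachable v x} := by
    rw [← inter_assoc, inter_comm _ ({ω : BondConfig V | openEdgeCluster ω v ∈ 𝒜}), inter_assoc,
      inter_eq_right.2 (R_anti v hXX')]
  have e2 : {ω : BondConfig V | ∀ x ∈ X, ¬ (openGraph ω).Reachable v x} ∩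
      {ω : BondConfig V | ∀ x ∈ X', ¬ (openGraph ω).Reachable v x} =
      {ω : BondConfig V | ∀ x ∈ X', ¬ (openGraph ω).Reachable v x} :=
    inter_eq_right.2 (R_anti v hXX')
  rw [e1, e2, inter_comm _ ({ω : BondConfig V | openEdgeCluster ω v ∈ 𝒜})] at key
  exact key

/-- **BHK Thm. 1.3 (decreasing × decreasing): the avoidance function is log-supermodular**,
`μ(R_X) μ(R_Y) ≤ μ(R_{X ∩ Y}) μ(R_{X ∪ Y})`, for `v ∉ X ∪ Y`.
[cite: VandenbergHaggstromKahn2005, Thm. 1.3 (p. 6) and Remark 2 (p. 8)] -/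
theorem logsuper [DecidableEq V] {X Y : Finset V} (hvX : v ∉ X) (hvY : v ∉ Y) :
    (prodBernoulli w).real {ω : BondConfig V | ∀ x ∈ X, ¬ (openGraph ω).Reachable v x} *
      (prodBernoulli w).real {ω : BondConfig V | ∀ x ∈ Y, ¬ (openGraph ω).Reachable v x} ≤
    (prodBernoulli w).real {ω : BondConfig V | ∀ x ∈ X ∩ Y, ¬ (openGraph ω).Reachable v x} *
      (prodBernoulli w).real {ω : BondConfig V | ∀ x ∈ X ∪ Y, ¬ (openGraph ω).Reachable v x} := by
  have hvXY : v ∉ X ∩ Y := fun h => hvX (Finset.mem_inter.1 h).1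
  have hv' : v ∉ (↑(X ∩ Y) : Set V) := fun h => hvXY (Finset.mem_coe.1 h)
  have key := MixedAvoidance.bhk_one_lower_lower w v (↑(X ∩ Y) : Set V) hv'
    (isLowerSet_avoidFam X) (isLowerSet_avoidFam Y)
  have e0 : {ω : BondConfig V | ∀ x ∈ (↑(X ∩ Y) : Set V), ¬ (openGraph ω).Reachable v x} =
      {ω : BondConfig V | ∀ x ∈ X ∩ Y, ¬ (openGraph ω).Reachable v x} := by
    ext ω; simp only [mem_setOf_eq, Finset.mem_coe]
  rw [e0, setOf_cluster_avoid_eq v X hvX, setOf_cluster_avoid_eq v Y hvY] at key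
  have e1 : {ω : BondConfig V | ∀ x ∈ X ∩ Y, ¬ (openGraph ω).Reachable v x} ∩
      {ω : BondConfig V | ∀ x ∈ X, ¬ (openGraph ω).Reachable v x} =
      {ω : BondConfig V | ∀ x ∈ X, ¬ (openGraph ω).Reachable v x} :=
    inter_eq_right.2 (R_anti v Finset.inter_subset_left)
  have e2 : {ω : BondConfig V | ∀ x ∈ X ∩ Y, ¬ (openGraph ω).Reachable v x} ∩
      {ω : BondConfig V | ∀ x ∈ Y, ¬ (openGraph ω).Reachable v x} =
      {ω : BondConfig V | ∀ x ∈ Y, ¬ (openGraph ω).Reachable v x} :=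
    inter_eq_right.2 (R_anti v Finset.inter_subset_right)
  have e3 : {ω : BondConfig V | ∀ x ∈ X ∩ Y, ¬ (openGraph ω).Reachable v x} ∩
      ({ω : BondConfig V | ∀ x ∈ X, ¬ (openGraph ω).Reachable v x} ∩
        {ω : BondConfig V | ∀ x ∈ Y, ¬ (openGraph ω).Reachable v x}) =
      {ω : BondConfig V | ∀ x ∈ X ∪ Y, ¬ (openGraph ω).Reachable v x} := by
    rw [← R_union, inter_eq_right.2 (R_anti v (Finset.inter_subset_left.trans
      Finset.subset_union_left))]
  rw [e1, e2, e3] at key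
  exact key

end AvoidanceCovBernstein

end Summit.CriticalPhenomena.PercolationContinuityZ3.Theorems
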